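import Summits.Ventures.Crystal3D.Theorems.StickyWulffConstantNoReconstructionGainExactClassReplication
import Summits.Ventures.Crystal3D.Theorems.StickyWulffConstantNoReconstructionGainExactLevelBound
import HarnessLib

/-!
# Criminals are contact-connected WLOG; no criminal is locally registered (line `replication-exactness`)

HONEST FRAMING. Part of the venture `Summits/Ventures/Crystal3D` (cell `crystal3d-full`), supports the
crux `NoReconstructionGain` (stmt-Ventures-19144, route `route-Ventures-StickyWulffConstant`), line
`replication-exactness` (lead wulff-p1 g18).  Structure of minimal counterexamples to EXACT₀
(`IsCriminal`, `…ExactDefs`): the block inequalities pass to every contact-isolated sub-film, so a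
criminal may be assumed CONNECTED through unit contacts; and a criminal has a plugged ball.  Combined
with the third-lattice theorem (`not_isCriminal_of_subset_thirdLattice`, `…ExactClassReplication`)
this excludes every LOCALLY REGISTERED film: it suffices that the difference of any two touching
film balls, and of any film ball and any of its plugs, lies in `(1/3)Λ₀` — the positions themselves
are then forced into `(1/3)Λ₀` along the contact component of a plugged ball.  All Barlow local
environments of all four `{111}` families of the substrate (fcc, hcp, twinned, multiply twinned,
varying from ball to ball) have their bond vectors in `(1/3)Λ₀`.

* `IsCriminal.of_isolated` — a nonempty sub-film receiving no contact from the rest is a criminal;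
* `isCriminal_component` — the contact component of any ball of a criminal is a criminal;
* `exists_plug_of_criminal` — a criminal has a ball with a plug;
* `thirdLattice_add` — `(1/3)Λ₀` is closed under addition;
* `not_isCriminal_of_localRegistry` — **no criminal is locally registered** (bond vectors between
  touching balls and ball-minus-plug vectors all in `(1/3)Λ₀`), on any face.

WHAT THIS IS NOT: the crux; rung F-C1 not moved.
-/

noncomputable section

namespace Summit.Ventures.Crystal3D.Theorems

open Summit.Ventures.Crystal3D
open Literature.MathematicalPhysics.StatisticalMechanics (fccStacking barlowStacking barlowPos constHagg
  haggLabel_const barlowPos_apply_zero barlowPos_apply_one barlowPos_apply_two contactDeficiency)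
open scoped InnerProductSpace
open Finset

/-- **Isolated sub-films of a criminal are criminals.** -/
theorem IsCriminal.of_isolated {ν : EuclideanSpace ℝ (Fin 3)} {s : ℝ}
    {Q U : Finset (EuclideanSpace ℝ (Fin 3))} (hQ : IsCriminal ν s Q) (hUQ : U ⊆ Q) (hU : U.Nonempty)
    (hiso : ∀ x ∈ U, ∀ y ∈ Q, y ∉ U → dist x y ≠ 1) : IsCriminal ν s U := by
  classical
  refine ⟨⟨fun q hq q' hq' hne => hQ.1.1 q (hUQ hq) q' (hUQ hq') hne,
    fun q hq p hp => hQ.1.2 q (hUQ hq) p hp⟩, hU, fun V hVU hV => ?_⟩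
  have h := hQ.2.2 V (hVU.trans hUQ) hV
  have e : (((Q \ V) ×ˢ V).filter fun pq => dist pq.1 pq.2 = 1) =
      (((U \ V) ×ˢ V).filter fun pq => dist pq.1 pq.2 = 1) := by
    ext ⟨y, x⟩
    simp only [Finset.mem_filter, Finset.mem_product, Finset.mem_sdiff]
    constructor
    · rintro ⟨⟨⟨hyQ, hyV⟩, hxV⟩, hd⟩
      refine ⟨⟨⟨?_, hyV⟩, hxV⟩, hd⟩
      by_contra hyU
      exact hiso x (hVU hxV) y hyQ hyU (by rw [dist_comm]; exact hd)
    · rintro ⟨⟨⟨hyU, hyV⟩, hxV⟩, hd⟩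
      exact ⟨⟨⟨hUQ hyU, hyV⟩, hxV⟩, hd⟩
  rw [e] at h
  exact h

open scoped Classical in
/-- **The contact component of any ball of a criminal is a criminal** (criminals may be assumed
connected through unit contacts). -/
theorem isCriminal_component {ν : EuclideanSpace ℝ (Fin 3)} {s : ℝ}
    {Q : Finset (EuclideanSpace ℝ (Fin 3))} (hQ : IsCriminal ν s Q) {q₀ : EuclideanSpace ℝ (Fin 3)}
    (hq₀ : q₀ ∈ Q) :
    IsCriminal ν s (Q.filter fun x =>
      Relation.ReflTransGen (fun a b => a ∈ Q ∧ b ∈ Q ∧ dist a b = 1) q₀ x) := by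
  refine hQ.of_isolated (Finset.filter_subset _ _)
    ⟨q₀, Finset.mem_filter.2 ⟨hq₀, Relation.ReflTransGen.refl⟩⟩ fun x hx y hy hyU hd => hyU ?_
  rw [Finset.mem_filter] at hx ⊢
  exact ⟨hy, hx.2.tail ⟨hx.1, hy, hd⟩⟩

/-- **A criminal has a plugged ball.** -/
theorem exists_plug_of_criminal {ν : EuclideanSpace ℝ (Fin 3)} {s : ℝ}
    {Q : Finset (EuclideanSpace ℝ (Fin 3))} (hQ : IsCriminal ν s Q) :
    ∃ q ∈ Q, (plugSet ν s q).Nonempty := by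
  classical
  obtain ⟨hfilm, hne, hcore⟩ := hQ
  have h1 := hcore Q (Finset.Subset.refl Q) hne
  simp only [Finset.sdiff_self, Finset.empty_product, Finset.filter_empty, Finset.card_empty,
    Nat.cast_zero, add_zero] at h1
  have h0 := contactDeficiency_nonneg_of_packing Q hfilm.1
  have hpos : 0 < plugCount ν s Q := by exact_mod_cast h0.trans_lt h1
  by_contra hno
  push Not at hno
  have : plugCount ν s Q = 0 := by
    unfold plugCount
    exact Finset.sum_eq_zero fun q hq => by rw [hno q hq, Set.ncard_empty]
  omega

/-- `(1/3)Λ₀` is closed under addition. -/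
theorem thirdLattice_add {u v : EuclideanSpace ℝ (Fin 3)}
    (hu : ∃ K I J : ℤ, u = (1 / 3 : ℝ) • barlowPos 1 (Real.sqrt (2 / 3)) constHagg K I J)
    (hv : ∃ K I J : ℤ, v = (1 / 3 : ℝ) • barlowPos 1 (Real.sqrt (2 / 3)) constHagg K I J) :
    ∃ K I J : ℤ, u + v = (1 / 3 : ℝ) • barlowPos 1 (Real.sqrt (2 / 3)) constHagg K I J := by
  obtain ⟨K, I, J, rfl⟩ := hu
  obtain ⟨K', I', J', rfl⟩ := hv
  refine ⟨K + K', I + I', J + J', ?_⟩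
  ext l
  fin_cases l <;>
    simp [barlowPos_apply_zero, barlowPos_apply_one, barlowPos_apply_two, haggLabel_const] <;> ring

open scoped Classical in
/-- **No criminal is locally registered.**  If the difference of any two touching film balls and
the difference of any film ball and any of its plugs lie in `(1/3)Λ₀`, the film is not a criminal,
on any face (positions are forced into `(1/3)Λ₀` along the contact component of a plugged ball). -/
theorem not_isCriminal_of_localRegistry {ν : EuclideanSpace ℝ (Fin 3)} (hν : ‖ν‖ = 1) {s : ℝ}
    {Q : Finset (EuclideanSpace ℝ (Fin 3))}
    (hQQ : ∀ x ∈ Q, ∀ y ∈ Q, dist x y = 1 →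
      ∃ K I J : ℤ, y - x = (1 / 3 : ℝ) • barlowPos 1 (Real.sqrt (2 / 3)) constHagg K I J)
    (hPQ : ∀ q ∈ Q, ∀ p ∈ plugSet ν s q,
      ∃ K I J : ℤ, q - p = (1 / 3 : ℝ) • barlowPos 1 (Real.sqrt (2 / 3)) constHagg K I J) :
    ¬ IsCriminal ν s Q := by
  classical
  intro hcrim
  obtain ⟨q₀, hq₀, p, hp⟩ := exists_plug_of_criminal hcrim
  -- the plugged ball is registered
  have hq₀r : ∃ K I J : ℤ, q₀ = (1 / 3 : ℝ) • barlowPos 1 (Real.sqrt (2 / 3)) constHagg K I J := by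
    have h := thirdLattice_add_fcc_mem (hPQ q₀ hq₀ p hp) hp.1.1
    rwa [sub_add_cancel] at h
  -- its contact component is a registered criminal
  refine not_isCriminal_of_subset_thirdLattice hν (fun x hx => ?_) (isCriminal_component hcrim hq₀)
  rw [Finset.mem_filter] at hx
  obtain ⟨-, hpath⟩ := hx
  induction hpath with
  | refl => exact hq₀r
  | tail _ hab ih =>
    obtain ⟨ha, hb, hd⟩ := hab
    have h := thirdLattice_add ih (hQQ _ ha _ hb hd)
    rwa [add_sub_cancel] at h

end Summit.Ventures.Crystal3D.Theorems

end
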